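import Mathlib
import HarnessLib.Audit
import Summits.PneNP.PneNP.Theorems.PstarNorUnitEQ1Tools

/-!
# (EXC) against any quadratic with polar form `polarDir`: CONS-T unit or (EQ), with the polar formula (ROUND-24, memo §9 R7/R8, residue (c2))

FRONTIER range-avoidance ladder, rung F-N3, ROUND 24 (cell `pnp-ideate`, planner memo `r24/CORE-BOUND-NOTES.md` §9 R5–R8, §10; restricted-model proof
complexity — nothing here bears on `P` versus `NP`).

`exc_unit_core` is `PstarNorUnitExc.exc_unit_of_dir` with two generalisations needed by the assembly of the direction picture:

* the reference quadratic `q` is ANY function with polar form `polarDir I B m` (so `q_m + ζ`, and the shifted partner coordinate `q_{m'} + c` of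
  `PstarNorUnitEQ1`), the containment being `Z(q) ⊆ {Q_{D e} = c₀}` for any constant `c₀`;
* in the unit case the conclusion also records THE POLAR FORMULA on basis vectors:
  `polarDir I B m (e_v, e_w) = [v, w AND-adjacent in D e] + [{v,w} = {σ,τ}]` — the realiser family of direction `m` has AND-graph exactly the path
  `b — σ — τ — b'` (the two unit edges and the gadget).  (From `polar(Q_{D e}) = polarDir + ℓ₁∧ℓ₂` and `ℓ₁∧ℓ₂ = e_σ^* ∧ e_τ^*`: the linear parts are
  non-zero, distinct — dual directions — and supported on `{σ,τ}` — single literals.)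

Proof otherwise verbatim as in `PstarNorUnitExc` (dependent linear parts ⟹ (EQ) or rank `≤ 2`; independent: `d = 1` ⟹ rank `≤ 2`, `d = 0` ⟹ the
NOR-unit identity `Q + κ = (μ₁+1)(a₁+μ₂) + (μ₂+1)(a₂+1)` and `PstarNorUnitNA.nor_unit_na`).
-/

set_option linter.dupNamespace false -- `Summit.PneNP.PneNP.…`: summit = sub-problem name (D-0017 single-conjunct layout)

open Finset Module Literature.Computability.Complexity
open Summit.PneNP.PneNP.Theorems.PstarSALevel (varSet bdry BoundaryExpanding SimpleOverlap)
open Summit.PneNP.PneNP.Theorems.PstarGapLinearised (andPair)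
open Summit.PneNP.PneNP.Theorems.PstarChordEndgameTools (mem_andPair_iff)
open Summit.PneNP.PneNP.Theorems.PstarCubeIdeals (IsAffineFn IsQuadFn isAffineFn_const exists_affine_of_codimTwo exists_affine_mul_of_hyperplane
  flips_of_affine exists_dual_of_affine)
open Summit.PneNP.PneNP.Theorems.PstarQuadRank (rad)
open Summit.PneNP.PneNP.Theorems.PstarRankRigidityTwo (linPart symForm symForm_apply linPart_apply affine_mul_polar)
open Summit.PneNP.PneNP.Theorems.PstarForcing (polar_unique not_rank_four_of_mul)
open Summit.PneNP.PneNP.Theorems.PstarProductRank (qform polar)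
open Summit.PneNP.PneNP.Theorems.PstarPathRank (AndAdj polar_basis)
open Summit.PneNP.PneNP.Theorems.PstarChordBridgeTools (xpdeg)
open Summit.PneNP.PneNP.Theorems.PstarChordBridge (BridgeData sys)
open Summit.PneNP.PneNP.Theorems.PstarReadSumset (V2)
open Summit.PneNP.PneNP.Theorems.PstarChordBridgeForcing (freeMon freePolar gam qform_add' rank_four_of_wf)
open Summit.PneNP.PneNP.Theorems.PstarChordBridgeBasis (qDir polarDir)
open Summit.PneNP.PneNP.Theorems.PstarNorUnitNA (nor_unit_na)
open Summit.PneNP.PneNP.Theorems.PstarNorUnitBridge (xor_not_mem_bdry_of_even)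
open Summit.PneNP.PneNP.Theorems.PstarNorUnitDir (exists_realiser_of_polarDir)

namespace Summit.PneNP.PneNP.Theorems.PstarNorUnitExcCore

variable {n m : ℕ}

/-- **(EXC) ⟹ CONS-T unit with the polar formula, or (EQ).**  See the module docstring. -/
theorem exc_unit_core (I : LocalMap 4 n m) (hI : I.IsPure xorAndPred) (hS : SimpleOverlap I) {r : ℕ} (hB : BoundaryExpanding r I)
    {B : BridgeData n m} (hW : B.WF I) (hr : (B.J₀ ∪ B.G₁ ∪ B.G₂).card ≤ r) {e : Fin m} (he : e ∈ B.N) (heG : e ∉ B.G₁ ∪ B.G₂) (mv : V2)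
    {q : (Fin n → ZMod 2) → ZMod 2} (hqB : ∀ x w, q (x + w) = q x + q w + q 0 + polarDir I B mv x w) {c₀ : ZMod 2}
    (hZ : ∀ x, q x = 0 → qform (B.D e) (fun j => I.vars j 2) (fun j => I.vars j 3) x = c₀)
    {μ₁ μ₂ : (Fin n → ZMod 2) → ZMod 2} (hμ₁ : IsAffineFn μ₁) (hμ₂ : IsAffineFn μ₂) {κ : ZMod 2}
    (hEXC : ∀ x, qform (B.D e) (fun j => I.vars j 2) (fun j => I.vars j 3) x = q x + μ₁ x * μ₂ x + κ) :
    (∃ κ' : ZMod 2, ∀ x, qform (B.D e) (fun j => I.vars j 2) (fun j => I.vars j 3) x = q x + κ') ∨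
    (∃ j₁ j₂ : Fin m, ∃ σ τ : Fin n, j₁ ≠ j₂ ∧ B.D e = {j₁, j₂} ∧ Disjoint (andPair I j₁) (andPair I j₂) ∧
      σ ∈ andPair I j₁ ∧ τ ∈ andPair I j₂ ∧
      (∀ v : Fin n, (μ₁ (Pi.single v 1) ≠ μ₁ 0 ∨ μ₂ (Pi.single v 1) ≠ μ₂ 0) ↔ (v = σ ∨ v = τ)) ∧
      (∀ v w : Fin n, polarDir I B mv (Pi.single v 1) (Pi.single w 1) =
        (if AndAdj I (B.D e) v w then 1 else 0) + (if (v = σ ∧ w = τ) ∨ (v = τ ∧ w = σ) then 1 else 0)) ∧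
      ∃ g ∈ B.T₁ ∪ freeMon I B.N B.G₁ ∪ (B.T₂ ∪ freeMon I B.N B.G₂), σ ∈ andPair I g ∧ τ ∈ andPair I g) := by
  classical
  have z01 : ∀ a : ZMod 2, a = 0 ∨ a = 1 := by decide
  have heD : e ∉ B.D e := fun h => (mem_sdiff.1 (hW.hD e he h)).2 he
  have hJr : B.J₀.card ≤ r := (card_le_card (subset_union_left.trans subset_union_left)).trans hr
  have hB' := qform_add' I (B.D e)
  have hrank := rank_four_of_wf I hI hS hB hW hJr he
  have hquad : IsQuadFn (fun x => q x + 1) := by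
    refine ⟨polarDir I B mv, fun x w => ?_⟩
    show q (x + w) + 1 = q x + 1 + (q w + 1) + (q 0 + 1) + polarDir I B mv x w
    rw [hqB]
    generalize q x = s; generalize q w = s'; generalize q 0 = s₀
    generalize polarDir I B mv x w = t
    revert s s' s₀ t; decide
  -- the value of `μ₁μ₂` on `Z`
  set d : ZMod 2 := c₀ + κ with hd
  have hdZ : ∀ x, q x = 0 → μ₁ x * μ₂ x = d := by
    intro x hx
    have h1 := hZ x hx
    rw [hEXC x, hx, zero_add] at h1
    have e1 : ∀ p k g : ZMod 2, p + k = g → p = g + k := by decide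
    exact e1 _ _ _ h1
  -- off the `d`-level set of `μ₁μ₂`, `q_m = 1`
  have hoff : ∀ x, μ₁ x * μ₂ x ≠ d → q x + 1 = 0 := by
    intro x hx
    rcases z01 (q x) with h0 | h1
    · exact absurd (hdZ x h0) hx
    · rw [h1]; decide
  by_cases hind : (∃ a, μ₁ a ≠ μ₁ 0 ∧ μ₂ a = μ₂ 0) ∧ (∃ b, μ₁ b = μ₁ 0 ∧ μ₂ b ≠ μ₂ 0)
  · -- independent linear parts: dual directions
    obtain ⟨⟨a, ha⟩, ⟨b, hb⟩⟩ := hind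
    obtain ⟨h₁₁, h₂₁, h₁₂, h₂₂⟩ := exists_dual_of_affine hμ₁ hμ₂ ha hb
    rcases z01 d with hd0 | hd1
    · -- `d = 0`: `q_m + 1` vanishes on the flat `{μ₁ + 1 = μ₂ + 1 = 0}`
      right
      have hflatZ : ∀ x, μ₁ x + 1 = 0 → μ₂ x + 1 = 0 → q x + 1 = 0 := by
        intro x h1 h2
        refine hoff x ?_
        rw [hd0]
        have e2 : ∀ u v : ZMod 2, u + 1 = 0 → v + 1 = 0 → u * v ≠ 0 := by decide
        exact e2 _ _ h1 h2
      have hl₂' : IsAffineFn (fun x => μ₂ x + 1) := by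
        intro x w
        show μ₂ (x + w) + 1 = μ₂ x + 1 + (μ₂ w + 1) + (μ₂ 0 + 1)
        rw [hμ₂]
        generalize μ₂ x = s; generalize μ₂ w = s'; generalize μ₂ 0 = s₀
        revert s s' s₀; decide
      obtain ⟨a₁, a₂, ha₁, ha₂, hrep⟩ := exists_affine_of_codimTwo (f := fun x => q x + 1)
        (l₁ := fun x => μ₁ x + 1) (l₂ := fun x => μ₂ x + 1) (v₁ := a) (v₂ := b)
        (fun x => by show μ₁ (x + a) + 1 = μ₁ x + 1 + 1; rw [h₁₁ x])
        (fun x => by show μ₂ (x + a) + 1 = μ₂ x + 1; rw [h₂₁ x])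
        (fun x => by show μ₁ (x + b) + 1 = μ₁ x + 1; rw [h₁₂ x])
        (fun x => by show μ₂ (x + b) + 1 = μ₂ x + 1 + 1; rw [h₂₂ x])
        hquad hflatZ hl₂'
      -- the NOR-unit data
      have hμ₁' : IsAffineFn (fun x => μ₁ x + 1) := by
        intro x w
        show μ₁ (x + w) + 1 = μ₁ x + 1 + (μ₁ w + 1) + (μ₁ 0 + 1)
        rw [hμ₁]
        generalize μ₁ x = s; generalize μ₁ w = s'; generalize μ₁ 0 = s₀
        revert s s' s₀; decide
      have hμ₂' : IsAffineFn (fun x => μ₂ x + 1) := hl₂'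
      have hm₁ : IsAffineFn (fun x => a₁ x + μ₂ x) := ha₁.add hμ₂
      have hm₂ : IsAffineFn (fun x => a₂ x + 1) := by
        intro x w
        show a₂ (x + w) + 1 = a₂ x + 1 + (a₂ w + 1) + (a₂ 0 + 1)
        rw [ha₂]
        generalize a₂ x = s; generalize a₂ w = s'; generalize a₂ 0 = s₀
        revert s s' s₀; decide
      have hQ' : ∀ x, qform (B.D e) (fun j => I.vars j 2) (fun j => I.vars j 3) x + κ =
          (fun x => μ₁ x + 1) x * (fun x => a₁ x + μ₂ x) x + (fun x => μ₂ x + 1) x * (fun x => a₂ x + 1) x := by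
        intro x
        have h : q x + 1 = (μ₁ x + 1) * a₁ x + (μ₂ x + 1) * a₂ x := hrep x
        show qform (B.D e) (fun j => I.vars j 2) (fun j => I.vars j 3) x + κ = (μ₁ x + 1) * (a₁ x + μ₂ x) + (μ₂ x + 1) * (a₂ x + 1)
        rw [hEXC x]
        revert h
        generalize q x = s; generalize μ₁ x = u; generalize μ₂ x = v; generalize a₁ x = A; generalize a₂ x = A'
        generalize κ = k
        revert s u v A A' k; decide
      -- linear parts of `μᵢ + 1` are those of `μᵢ`
      have hlin : ∀ {μ : (Fin n → ZMod 2) → ZMod 2} (hμ : IsAffineFn μ) (hμ' : IsAffineFn (fun x => μ x + 1)) (y : Fin n → ZMod 2),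
          linPart hμ' y = linPart hμ y := by
        intro μ hμ hμ' y
        rw [linPart_apply, linPart_apply]
        show μ y + 1 + (μ 0 + 1) = μ y + μ 0
        generalize μ y = s; generalize μ 0 = s₀
        revert s s₀; decide
      -- the polar identity of `Q = q + μ₁μ₂ + κ`
      have hpolQ : polar (B.D e) (fun j => I.vars j 2) (fun j => I.vars j 3) = polarDir I B mv + symForm (linPart hμ₁) (linPart hμ₂) := by
        refine polar_unique hB' fun x w => ?_
        rw [hEXC (x + w), hEXC x, hEXC w, hEXC 0, hqB, affine_mul_polar hμ₁ hμ₂, LinearMap.add_apply, LinearMap.add_apply]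
        generalize q x = s; generalize q w = s'; generalize q 0 = s₀
        generalize polarDir I B mv x w = t; generalize μ₁ x * μ₂ x = p; generalize μ₁ w * μ₂ w = p'; generalize μ₁ 0 * μ₂ 0 = p₀
        generalize symForm (linPart hμ₁) (linPart hμ₂) x w = t'; generalize κ = k
        revert s s' s₀ t p p' p₀ t' k; decide
      -- the gadget set
      set G : Finset (Fin m) := (B.T₁ ∪ freeMon I B.N B.G₁ ∪ (B.T₂ ∪ freeMon I B.N B.G₂)).filter fun g => g ∉ insert e (B.D e) with hGdef
      have hGd : Disjoint G (insert e (B.D e)) := by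
        rw [Finset.disjoint_left]
        intro g hg
        exact (mem_filter.1 hg).2
      have hsub : insert e (B.D e) ∪ G ⊆ B.J₀ ∪ B.G₁ ∪ B.G₂ := by
        intro g hg
        rcases mem_union.1 hg with hg | hg
        · rcases mem_insert.1 hg with rfl | hg
          · exact mem_union_left _ (mem_union_left _ (hW.hN he))
          · exact mem_union_left _ (mem_union_left _ (mem_sdiff.1 (hW.hD e he hg)).1)
        · have hg' := (mem_filter.1 hg).1
          rcases mem_union.1 hg' with hg' | hg' <;> rcases mem_union.1 hg' with hg' | hg'
          · exact mem_union_left _ (mem_union_left _ (mem_sdiff.1 (hW.hT₁ hg')).1)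
          · exact mem_union_left _ (mem_union_right _ (mem_filter.1 hg').1)
          · exact mem_union_left _ (mem_union_left _ (mem_sdiff.1 (hW.hT₂ hg')).1)
          · exact mem_union_right _ (mem_filter.1 hg').1
      have hr' : (insert e (B.D e) ∪ G).card ≤ r := (card_le_card hsub).trans hr
      have hcyc := xor_not_mem_bdry_of_even I hI (hW.hDeven e he)
      have hK : ∀ v w : Fin n, v ≠ w → ¬ AndAdj I (B.D e) v w →
          linPart hμ₁' (Pi.single v 1) * linPart hμ₂' (Pi.single w 1) + linPart hμ₁' (Pi.single w 1) * linPart hμ₂' (Pi.single v 1) = 1 →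
            ∃ g ∈ G, v ∈ andPair I g ∧ w ∈ andPair I g := by
        intro v w hvw hna hdet
        rw [hlin hμ₁ hμ₁', hlin hμ₁ hμ₁', hlin hμ₂ hμ₂', hlin hμ₂ hμ₂'] at hdet
        -- evaluate the polar identity at `(e_v, e_w)`: the left side vanishes (not adjacent)
        have h := LinearMap.congr_fun (LinearMap.congr_fun hpolQ (Pi.single v 1)) (Pi.single w 1)
        rw [polar_basis I hI hS, if_neg hna, LinearMap.add_apply, LinearMap.add_apply, symForm_apply, hdet] at h
        have hval : polarDir I B mv (Pi.single v 1) (Pi.single w 1) = 1 := by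
          have e3 : ∀ t : ZMod 2, (0 : ZMod 2) = t + 1 → t = 1 := by decide
          exact e3 _ h
        obtain ⟨g, hg, hvg, hwg⟩ := exists_realiser_of_polarDir I hI hS B mv hval
        refine ⟨g, mem_filter.2 ⟨hg, fun hge => ?_⟩, hvg, hwg⟩
        rcases mem_insert.1 hge with rfl | hgD
        · rcases mem_union.1 hg with h | h <;> rcases mem_union.1 h with h | h
          · exact (mem_sdiff.1 (hW.hT₁ h)).2 he
          · exact heG (mem_union_left _ (mem_filter.1 h).1)
          · exact (mem_sdiff.1 (hW.hT₂ h)).2 he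
          · exact heG (mem_union_right _ (mem_filter.1 h).1)
        · refine hna ?_
          rw [mem_andPair_iff] at hvg hwg
          rcases hvg with rfl | rfl <;> rcases hwg with rfl | rfl
          · exact absurd rfl hvw
          · exact ⟨g, hgD, Or.inl ⟨rfl, rfl⟩⟩
          · exact ⟨g, hgD, Or.inr ⟨rfl, rfl⟩⟩
          · exact absurd rfl hvw
      obtain ⟨j₁, j₂, σ, τ, hne, hDe, hdisj, hσ, hτ, hlit, g, hg, hσg, hτg⟩ :=
        nor_unit_na hI hS hB heD hGd hr' hcyc hμ₁' hμ₂' hm₁ hm₂ hQ' hK hrank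
      have hστ : σ ≠ τ := fun h => Finset.disjoint_left.1 hdisj hσ (h ▸ hτ)
      -- the literal supports of `ℓ₁, ℓ₂` on basis vectors
      have hlit' : ∀ v, (linPart hμ₁ (Pi.single v 1) ≠ 0 ∨ linPart hμ₂ (Pi.single v 1) ≠ 0) ↔ (v = σ ∨ v = τ) := by
        intro v; rw [← hlit v, hlin hμ₁ hμ₁', hlin hμ₂ hμ₂']
      have hoffστ : ∀ u, ¬ (u = σ ∨ u = τ) → linPart hμ₁ (Pi.single u 1) = 0 ∧ linPart hμ₂ (Pi.single u 1) = 0 := by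
        intro u hu
        by_contra hno
        rw [not_and_or] at hno
        rcases hno with h | h
        · exact hu ((hlit' u).1 (Or.inl h))
        · exact hu ((hlit' u).1 (Or.inr h))
      -- a linear functional vanishing on every basis vector vanishes
      have ext0 : ∀ L : (Fin n → ZMod 2) →ₗ[ZMod 2] ZMod 2, (∀ u, L (Pi.single u 1) = 0) → L = 0 := by
        intro L hL
        refine LinearMap.pi_ext fun i x => ?_
        rcases z01 x with rfl | rfl
        · simp
        · rw [hL i, LinearMap.zero_apply]
      -- `ℓ₁ ≠ 0`, `ℓ₂ ≠ 0`, `ℓ₁ ≠ ℓ₂` on `{e_σ, e_τ}`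
      have hdet : linPart hμ₁ (Pi.single σ 1) * linPart hμ₂ (Pi.single τ 1) + linPart hμ₁ (Pi.single τ 1) * linPart hμ₂ (Pi.single σ 1) = 1 := by
        have hA : ¬ (linPart hμ₁ (Pi.single σ 1) = 0 ∧ linPart hμ₁ (Pi.single τ 1) = 0) := by
          rintro ⟨h1, h2⟩
          have hz : linPart hμ₁ = 0 := ext0 _ fun u => by
            by_cases hu : u = σ ∨ u = τ
            · rcases hu with rfl | rfl
              · exact h1
              · exact h2
            · exact (hoffστ u hu).1
          have := LinearMap.congr_fun hz a
          rw [linPart_apply, LinearMap.zero_apply] at this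
          exact ha.1 (by have e := this; revert e; generalize μ₁ a = s; generalize μ₁ 0 = t; revert s t; decide)
        have hBv : ¬ (linPart hμ₂ (Pi.single σ 1) = 0 ∧ linPart hμ₂ (Pi.single τ 1) = 0) := by
          rintro ⟨h1, h2⟩
          have hz : linPart hμ₂ = 0 := ext0 _ fun u => by
            by_cases hu : u = σ ∨ u = τ
            · rcases hu with rfl | rfl
              · exact h1
              · exact h2
            · exact (hoffστ u hu).2
          have := LinearMap.congr_fun hz b
          rw [linPart_apply, LinearMap.zero_apply] at this
          exact hb.2 (by have e := this; revert e; generalize μ₂ b = s; generalize μ₂ 0 = t; revert s t; decide)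
        have hAB : ¬ (linPart hμ₁ (Pi.single σ 1) = linPart hμ₂ (Pi.single σ 1) ∧ linPart hμ₁ (Pi.single τ 1) = linPart hμ₂ (Pi.single τ 1)) := by
          rintro ⟨h1, h2⟩
          have hz : linPart hμ₁ - linPart hμ₂ = 0 := ext0 _ fun u => by
            rw [LinearMap.sub_apply, sub_eq_zero]
            by_cases hu : u = σ ∨ u = τ
            · rcases hu with rfl | rfl
              · exact h1
              · exact h2
            · rw [(hoffστ u hu).1, (hoffστ u hu).2]
          have := LinearMap.congr_fun hz a
          rw [LinearMap.sub_apply, LinearMap.zero_apply, sub_eq_zero, linPart_apply, linPart_apply, ha.2] at this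
          exact ha.1 (by have e := this; revert e; generalize μ₁ a = s; generalize μ₁ 0 = t; generalize μ₂ 0 = u; revert s t u; decide)
        revert hA hBv hAB
        generalize linPart hμ₁ (Pi.single σ 1) = a₁; generalize linPart hμ₁ (Pi.single τ 1) = a₂
        generalize linPart hμ₂ (Pi.single σ 1) = b₁; generalize linPart hμ₂ (Pi.single τ 1) = b₂
        revert a₁ a₂ b₁ b₂; decide
      refine ⟨j₁, j₂, σ, τ, hne, hDe, hdisj, hσ, hτ, fun v => ?_, fun v w => ?_, g, (mem_filter.1 hg).1, hσg, hτg⟩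
      · rw [← hlit' v, linPart_apply, linPart_apply]
        have e4 : ∀ s s₀ : ZMod 2, s + s₀ ≠ 0 ↔ s ≠ s₀ := by decide
        rw [e4, e4]
      · -- `polarDir = polar(D e) + ℓ₁ ∧ ℓ₂` on basis vectors
        have h := LinearMap.congr_fun (LinearMap.congr_fun hpolQ (Pi.single v 1)) (Pi.single w 1)
        rw [polar_basis I hI hS, LinearMap.add_apply, LinearMap.add_apply, symForm_apply] at h
        have e5 : ∀ A P S T : ZMod 2, A = P + S → S = T → P = A + T := by decide
        refine e5 _ _ _ _ h ?_
        have hss : ∀ s t : ZMod 2, s * t + s * t = 0 := by decide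
        by_cases hv : v = σ ∨ v = τ
        · by_cases hw : w = σ ∨ w = τ
          · rcases hv with hv | hv <;> rcases hw with hw | hw <;> rw [hv, hw]
            · rw [if_neg (by rintro (⟨-, h⟩ | ⟨h, -⟩) <;> exact hστ h)]
              exact hss _ _
            · rw [if_pos (Or.inl ⟨rfl, rfl⟩)]; exact hdet
            · rw [if_pos (Or.inr ⟨rfl, rfl⟩)]; linear_combination hdet
            · rw [if_neg (by rintro (⟨h, -⟩ | ⟨-, h⟩) <;> exact hστ h.symm)]
              exact hss _ _
          · rw [(hoffστ w hw).1, (hoffστ w hw).2, if_neg (by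
              rintro (⟨-, h⟩ | ⟨-, h⟩)
              · exact hw (Or.inr h)
              · exact hw (Or.inl h))]
            ring
        · rw [(hoffστ v hv).1, (hoffστ v hv).2, if_neg (by
            rintro (⟨h, -⟩ | ⟨h, -⟩)
            · exact hv (Or.inl h)
            · exact hv (Or.inr h))]
          ring
    · -- `d = 1`: `q_m + 1` vanishes on the hyperplane `{μ₁ = 0}`
      exfalso
      have hhyp : ∀ x, μ₁ x = 0 → q x + 1 = 0 := by
        intro x h1
        refine hoff x ?_
        rw [hd1, h1, zero_mul]
        exact zero_ne_one
      obtain ⟨m₀, hm₀, hrep⟩ := exists_affine_mul_of_hyperplane hquad h₁₁ hhyp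
      refine absurd hrank (not_rank_four_of_mul hB' hμ₁ (hm₀.add hμ₂) (κ := 1 + κ) fun x => ?_)
      have h : q x + 1 = μ₁ x * m₀ x := hrep x
      show qform (B.D e) (fun j => I.vars j 2) (fun j => I.vars j 3) x = μ₁ x * (m₀ x + μ₂ x) + (1 + κ)
      rw [hEXC x]
      revert h
      generalize q x = s; generalize μ₁ x = u; generalize μ₂ x = v; generalize m₀ x = A; generalize κ = k
      revert s u v A k; decide
  · -- dependent linear parts: `μ₁μ₂` is affine
    have hα : ∃ α : (Fin n → ZMod 2) → ZMod 2, IsAffineFn α ∧ ∀ x, μ₁ x * μ₂ x = α x := by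
      -- the three degenerate shapes: `μ₁` constant, `μ₂` constant, equal linear parts
      have key : ∀ {ν₁ ν₂ : (Fin n → ZMod 2) → ZMod 2}, IsAffineFn ν₁ → IsAffineFn ν₂ →
          (∀ a, ν₁ a ≠ ν₁ 0 → ν₂ a ≠ ν₂ 0) → ∃ α : (Fin n → ZMod 2) → ZMod 2, IsAffineFn α ∧ ∀ x, ν₁ x * ν₂ x = α x := by
        intro ν₁ ν₂ hν₁ hν₂ himp
        by_cases hc : ∀ a, ν₁ a = ν₁ 0
        · exact ⟨fun x => ν₁ 0 * ν₂ x, hν₂.const_mul _, fun x => by rw [hc x]⟩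
        · push Not at hc
          obtain ⟨a₀, ha₀⟩ := hc
          have hb₀ := himp a₀ ha₀
          -- the linear parts coincide
          have heq : ∀ x, ν₂ x + ν₂ 0 = ν₁ x + ν₁ 0 := by
            intro x
            rcases z01 (ν₁ x + ν₁ 0) with h0 | h1
            · -- `x + a₀` has `ν₁`-linear part `1`
              have hx1 : ν₁ (x + a₀) ≠ ν₁ 0 := by
                rw [hν₁]
                revert h0 ha₀
                generalize ν₁ x = s; generalize ν₁ a₀ = t; generalize ν₁ 0 = s₀
                revert s t s₀; decide
              have hx2 := himp _ hx1
              rw [hν₂] at hx2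
              rw [h0]
              revert hx2 hb₀
              generalize ν₂ x = s; generalize ν₂ a₀ = t; generalize ν₂ 0 = s₀
              revert s t s₀; decide
            · have hx1 : ν₁ x ≠ ν₁ 0 := by
                revert h1; generalize ν₁ x = s; generalize ν₁ 0 = s₀; revert s s₀; decide
              have hx2 := himp x hx1
              rw [h1]
              revert hx2; generalize ν₂ x = s; generalize ν₂ 0 = s₀; revert s s₀; decide
          refine ⟨fun x => (1 + ν₁ 0 + ν₂ 0) * ν₁ x, hν₁.const_mul _, fun x => ?_⟩
          have hx := heq x
          have e5 : ∀ u v u₀ v₀ : ZMod 2, v + v₀ = u + u₀ → u * v = (1 + u₀ + v₀) * u := by decide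
          exact e5 _ _ _ _ hx
      rw [not_and_or] at hind
      rcases hind with h | h
      · push Not at h
        exact key hμ₁ hμ₂ h
      · push Not at h
        obtain ⟨α, hα, hαx⟩ := key hμ₂ hμ₁ fun b hb ha => hb (h b ha)
        exact ⟨α, hα, fun x => by rw [mul_comm]; exact hαx x⟩
    obtain ⟨α, hαaff, hα⟩ := hα
    by_cases hαc : ∀ x, α x = α 0
    · left
      exact ⟨α 0 + κ, fun x => by rw [hEXC x, hα x, hαc x, add_assoc]⟩
    · exfalso
      push Not at hαc
      obtain ⟨v, hv⟩ := hαc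
      -- the hyperplane `{α + d + 1 = 0}` misses `Z`, so `q_m + 1` vanishes there
      have hlam : IsAffineFn (fun x => α x + (d + 1)) := by
        intro x w
        show α (x + w) + (d + 1) = α x + (d + 1) + (α w + (d + 1)) + (α 0 + (d + 1))
        rw [hαaff]
        generalize α x = s; generalize α w = s'; generalize α 0 = s₀; generalize d + 1 = k
        revert s s' s₀ k; decide
      have hflip : ∀ x, (fun x => α x + (d + 1)) (x + v) = (fun x => α x + (d + 1)) x + 1 :=
        flips_of_affine hlam (by show α v + (d + 1) ≠ α 0 + (d + 1); exact fun h' => hv (add_right_cancel h'))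
      have hhyp : ∀ x, (fun x => α x + (d + 1)) x = 0 → q x + 1 = 0 := by
        intro x hx
        refine hoff x ?_
        rw [hα x]
        have e6 : ∀ s k : ZMod 2, s + (k + 1) = 0 → s ≠ k := by decide
        exact e6 _ _ hx
      obtain ⟨m₀, hm₀, hrep⟩ := exists_affine_mul_of_hyperplane hquad hflip hhyp
      refine absurd hrank (not_rank_four_of_mul hB' hlam (hm₀.add (isAffineFn_const 1)) (κ := d + κ) fun x => ?_)
      have h : q x + 1 = (α x + (d + 1)) * m₀ x := hrep x
      show qform (B.D e) (fun j => I.vars j 2) (fun j => I.vars j 3) x = (α x + (d + 1)) * (m₀ x + 1) + (d + κ)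
      rw [hEXC x, hα x]
      revert h
      generalize q x = s; generalize α x = u; generalize m₀ x = A; generalize κ = k; generalize d = k'
      revert s u A k k'; decide


end Summit.PneNP.PneNP.Theorems.PstarNorUnitExcCore
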